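import Summits.AtomisticToContinuum.FouriersLaw.Theses.HoelderEscapeProfile
import Summits.AtomisticToContinuum.FouriersLaw.Theorems.LocalEnergyHalfHoelder.Negative.FrozenFlowExcluded
import Summits.AtomisticToContinuum.FouriersLaw.Theorems.LocalEnergyHalfHoelder.Negative.FalseWithoutGibbs
import Summits.AtomisticToContinuum.FouriersLaw.Theorems.LocalEnergyHalfHoelder.Negative.FalseWithoutPreservesMeasure
import Summits.AtomisticToContinuum.FouriersLaw.Theorems.LocalEnergyHalfHoelder.Negative.SlowTailExcluded

/-!
# Disproof of `LocalEnergyHalfHoelder` (K1, stmt-AtomisticToContinuum-16008) — findings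

Crux disprover's work file (refuter-cdisprove-stmt-AtomisticToContinuum-16008-0, cycle 1,
2026-08-17). Crux (route `HoelderEscapeProfile`, rank 2): for `pinnedChain ω₂ lam β γ`
(`ω₂, lam, β > 0`), `T > 0`, every GUARDED arena `(μ, D)` — `μ` a DLR Gibbs state at `T`, shift- and
momentum-reversal-invariant; `D` an `InfiniteChainDynamics` preserving `μ`, shift-covariant a.e. —
with `S(0,t) = Cov_μ(h_0, h_0∘φ_t)` for the split-bond site energy `h`: if `e^{-νt}S(0,t) ∈ L¹(0,∞)`
for all `ν > 0` then `∃ C ν₀ > 0`, `Ψ(ν) := ν∫₀^∞e^{-νt}S(0,t)dt ≤ C√ν` on `(0, ν₀]`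
(the site-energy spectral measure is `½`-Hölder at `0`).

## VERDICT OF CYCLE 1: NO KILL — and why it resists

1. JUNK-PROOF TYPING. K1 is an UPPER bound on a non-negative quantity built from Bochner integrals:
   every junk collapse (non-measurable `σ ↦ h(φ_tσ)`, `h_0 ∉ L²(μ)`, non-integrable Abel profile)
   sets the integrals to `0` and SATISFIES the conclusion; the only profile shape on which the
   conclusion fails is an atom / slow return, `S(0,t) ↛ 0` fast enough
   (`FrozenFlowExcluded.abelMean_shape_false_for_atom`). The one junk DYNAMICS producing it — the
   frozen flow — is excluded by `PreservesMeasure.1` + DLR non-atomicity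
   (`FrozenFlowExcluded.no_frozen_dynamics`, landed before this seat, p149840); an empty carrier is
   excluded by `PreservesMeasure.1` (`InfiniteChainDynamics.measure_eq_zero_of_carrier_empty`).
2. NO DE-VACUIFIED ARENA IN THE TREE. A genuine guarded `(μ, D)` is crux `SymmetricSetup`
   (stmt-11036, open, difficulty L): an unconditional `¬K1` would have to construct the
   infinite-volume anharmonic dynamics in a Gibbs state AND prove an anomalously slow on-site return
   — the positive direction (any decay at all, `K1₀ = σ_h({0}) = 0`) is already open for every
   anharmonic lattice (census § Decomposition (iv)).
3. PHYSICS. Expected TRUE at every `T > 0` with a `T`-dependent constant (diffusive calibration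
   `C = χ/(2√D)`; census numerics kit j024330: `√t·S(0,t)` plateaus at all probed points incl. the
   anticontinuum point, `Ψ/√ν` never rises above its diffusive asymptote; De Roeck–Huveneers
   asymptotic localisation inflates `C(T)`, it produces no atom). Faster-than-diffusive members
   (harmonic `lam = β = 0`: `S ≍ 1/t`, `Ψ ≍ ν log(1/ν)`) satisfy K1 with room — the fully
   harmonic member is no counterexample (the route header's "K1 FAILS at the harmonic member" reads
   K1 as an exact exponent; only `AbelSpreadCeiling` fails there); whether `0 < β` is load-bearing
   at high `T` is the hot-lump question below.
4. NEGATION ROUTES CLOSED: Mazur atom needs an `L²(μ)` conserved charge overlapping `h_0` (total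
   energy is not in `L²`; its finite-`N` shadow `χ/N` vanishes); exotic `μ`-preserving non-physical
   solution flows — no construction known, excluded in kind by Lanford a.e.-uniqueness /
   MPP essential skew-adjointness (census § Negation (2)); Gibbs non-uniqueness — shift-invariant
   DLR states of this 1-D transfer-operator chain are unique (the exponentially growing harmonic
   "boundary fields at infinity" are not shift-invariant), so `∀ μ` hides no non-ergodic mixture.

## (a) LOAD-BEARING ANALYSIS (theorems below; the heavy lifting is LANDED under
`Theorems/LocalEnergyHalfHoelder/Negative/`: `UniformOscillationFlow` p159152,
`UniformOscillationArena` p159433, `FalseWithoutGibbs` p159865, `FalseWithoutPreservesMeasure`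
p160247, `SlowTailExcluded` p161031; earlier seat: `FrozenFlowExcluded` p149840)

* DLR guard: LOAD-BEARING, and in its TWO-SITE content. `LocalEnergyHalfHoelderWithoutGibbs`
  (Gibbs ↦ probability, everything else verbatim) is FALSE:
  `localEnergyHalfHoelder_false_without_gibbs`, by the UNIFORM-OSCILLATION ARENA — `μ` = normalised
  Liouville measure of the one-body shell `{p²/2 + U(q) < U(1)}` on spatially uniform
  configurations, `D` = the same Duffing orbit `q̈ = -U'(q)` at every site (a genuine
  `InfiniteChainDynamics`: bond forces vanish identically; Liouville on the shell gives
  `PreservesMeasure`; shift/reversal invariance and shift-covariance hold) — on which `h_0` is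
  conserved along orbits, `S(0,t) ≡ Var h_0 > 0` (atom at frequency 0), `Ψ ≡ Var h_0 ≰ C√ν`.
  The arena passes the ONE-site DLR consequences used elsewhere in the tree
  (`FalseWithoutGibbs.μu_momentum_zero_null`, `μu_coord_eq_null`) and is killed only by the
  two-site one (`gibbs_coincidence_null`: `μ{σ 0 = σ 1} = 0` under DLR, `= 1` for the arena).
  READING: K1 is quantitatively a statement about how fast the TRUE Gibbs dynamics dephases
  neighbouring sites that start almost in phase (near the `k = 0` / uniform subspace the chain is an
  ensemble of identical uncoupled anharmonic clocks with amplitude-dependent frequency); a proof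
  must use the decoupling of neighbours under `μ` (conditional structure across sites), not just
  smoothness of one-site marginals.
* `PreservesMeasure`: LOAD-BEARING given a Gibbs state — without it the frozen `restDynamics`
  (`φ = id`, carrier `{rest}`) is admissible and gives `S ≡ Var_μ h_0 > 0` in any DLR state with
  `h_0 ∈ L²` (level sets of `h_0` are DLR-null): `localEnergyHalfHoelder_false_without_preservesMeasure_of_gibbsState`
  (conditional on the `μ`-half of SymmetricSetup + a moment bound; landed p160247).
* One-site non-atomicity is NOT ENOUGH: `localEnergyHalfHoelder_false_with_oneSite_guard` (proved
  below): replacing DLR by "probability + `μ{σ 0 = v} = 0` ∀v + `μ{p_0 = 0} = 0`" is refuted by the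
  same arena.
* Shift-invariance / reversal-invariance / shift-covariance of `D`: NOT KNOWN to be load-bearing
  for K1 (they serve FibreCalculus: evenness of `S` in `t`, `k`-space identities). Mutation note
  for provers: a proof of K1 that never uses them is plausible (K1 is a statement about one local
  observable under one invariant state).
* Abel-integrability guard: decoration against junk only (drop it and the junk integral `0`
  satisfies the bound); `|S(0,t)| ≤ Var h_0` makes it automatic once `t ↦ S(0,t)` is measurable.
* `∃ ν₀`: cosmetic (`FrozenFlowExcluded.sqrt_bound_extend`); `C` may depend on everything.
* Parameter guards `0 < lam`, `0 < β`: the fully harmonic member satisfies K1 (item 3);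
  `LocalEnergyHalfHoelderHarmonicAllowed` recorded (expected true at `lam = β = 0`; at `lam > 0 = β`
  it is the φ⁴ hot-lump question — see THE ONE SUBSTANTIVE THREAT below), no finite model.

## THE ONE SUBSTANTIVE THREAT IDENTIFIED (for cycle 2 / the lead): RARE HOT LUMPS
The uniform arena says K1 is about dephasing; its thermal shadow is the rare hot lump (thermal /
chaotic breather): a site energy `E = xT` occurs with Boltzmann weight `~e^{-x}` and, while it
survives, contributes `~T²x²e^{-x}` to `S(0,t)`. If the lump lifetime grows like `f(x) ~ e^{cx}`
then `S(0,t) ≳ T²(log t)²t^{-1/c}`: K1 FAILS (substantively, at that `T`) iff `c > 2`; power-law or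
`c < 2` growth is harmless (stretched-exponential / integrable tails). For `pinnedChain` with `β > 0`
both potentials are quartic, the high-energy dynamics is scale-free (no asymptotic decoupling of a
hot site from its neighbours: the bond force `βq_0³` is as strong as the pinning), so unbounded
growth of `f` is NOT expected — but it is unmeasured; for `β = 0` (φ⁴, harmonic coupling) hot sites
oscillate above the phonon band and decouple, the classical breather-lifetime literature
(Tsironis–Aubry 1996, Piazza–Lepri–Livi 2001/2003, Ivanchenko–Kanakov–Shalfeev–Flach 2004,
Eleftheriou–Flach 2005) reports very slow relaxation. Hence the guard `0 < β` MAY be load-bearing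
for K1 at high `T` (item 3 above only clears the fully harmonic member). Probe filed: kit job
j026019 (`compute/hot_lump_lifetime.py`: lifetime of an implanted lump `E = xT`, `x = 4…64`, in the
thermalised ring, pinned `T = 1, 4` and φ⁴ control; fit of `log τ` vs `x`; verdict `c` vs `2`).
The kill criterion in this form is kernel-checked: `SlowTailExcluded.not_halfHoelder_of_slow_tail`
(a tail `S(0,t) ≥ a t^{-α}`, `a > 0`, `α < ½`, bounded below, Abel-integrable ⇒ ¬ conclusion; Laplace
lower bound `Ψ(ν) ≥ (ae^{-1}/(1-α))ν^α − O(ν)`, `abel_lower_of_tail`).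

## (b) TIGHTNESS — nothing provable without the dynamics: the exponent `½` is attained in the
diffusive calibration (`Ψ ~ (χ/2√D)√(πν)`… numerics only).

## (c) NATURAL STRENGTHENINGS (recorded, not refutable in a finite model): `C` uniform in `T`
(false in calibration: `C(T) → ∞` as `lam·T → 0` and as `lam·T → ∞`); pointwise
`S(0,t) ≤ Ct^{-1/2}` (strictly stronger, census S⁺₁); bounded density of `σ_h` at `0` (census S⁺₂,
FALSE in the diffusive calibration `dσ_h/dω ≍ |ω|^{-1/2}`).

## (d) Targets: none (no line picked, `stuck_stubs = []`).
-/

noncomputable section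

namespace Summit.AtomisticToContinuum.FouriersLaw.Cruxes.LocalEnergyHalfHoelder.Disproof

open MeasureTheory Set
open Literature.MathematicalPhysics.KineticTheory.HeatConduction
open Summit.AtomisticToContinuum.FouriersLaw.Theorems.LocalEnergyHalfHoelder.Negative

/-! ## (a) Load-bearing hypotheses -/

/-- K1 with the DLR guard `IsChainGibbsMeasure T μ` weakened to `IsProbabilityMeasure μ`
(everything else verbatim). [folklore] -/
def LocalEnergyHalfHoelderWithoutGibbs : Prop :=
  ∀ ω₂ lam β γ : ℝ, 0 < ω₂ → 0 < lam → 0 < β → ∀ T : ℝ, 0 < T → ∀ μ : MeasureTheory.Measure Literature.MathematicalPhysics.KineticTheory.HeatConduction.ChainConfig, MeasureTheory.IsProbabilityMeasure μ → Literature.MathematicalPhysics.KineticTheory.HeatConduction.IsShiftInvariant μ → μ.map (fun σ : Literature.MathematicalPhysics.KineticTheory.HeatConduction.ChainConfig => fun x : ℤ => ((σ x).1, -(σ x).2)) = μ → ∀ D : Literature.MathematicalPhysics.KineticTheory.HeatConduction.InfiniteChainDynamics (Literature.MathematicalPhysics.KineticTheory.HeatConduction.pinnedChain ω₂ lam β γ),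 D.PreservesMeasure μ → (∀ t : ℝ, ∀ᵐ σ ∂μ, D.flow t (Literature.MathematicalPhysics.KineticTheory.HeatConduction.shift σ) = Literature.MathematicalPhysics.KineticTheory.HeatConduction.shift (D.flow t σ)) → ∀ h : Literature.MathematicalPhysics.KineticTheory.HeatConduction.ChainConfig → ℤ → ℝ, h = (fun (σ : Literature.MathematicalPhysics.KineticTheory.HeatConduction.ChainConfig) (x : ℤ) => (σ x).2 ^ 2 / 2 + (Literature.MathematicalPhysics.KineticTheory.HeatConduction.pinnedChain ω₂ lam β γ).U (σ x).1 + ((Literature.MathematicalPhysics.KineticTheory.HeatConduction.pinnedChain ω₂ lam β γ).V ((σ (x + 1)).1 - (σ x).1) + (Literature.MathematicalPhysics.KineticTheory.HeatConduction.pinnedChain ω₂ lam β γ).V ((σ x).1 - (σ (x - 1)).1)) / 2) → ∀ S : ℤ → ℝ → ℝ, S = (fun (x : ℤ) (t : ℝ) => ∫ σ, (h σ 0 - ∫ σ', h σ' 0 ∂μ) * (h (D.flow t σ) x - ∫ σ', h σ' 0 ∂μ) ∂μ) → (∀ ν : ℝ, 0 < ν → MeasureTheory.IntegrableOn (fun t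 : ℝ => Real.exp (-(ν * t)) * S 0 t) (Set.Ioi 0)) → ∃ C ν₀ : ℝ, 0 < ν₀ ∧ ∀ ν : ℝ, 0 < ν → ν ≤ ν₀ → ν * ∫ t in Set.Ioi (0:ℝ), Real.exp (-(ν * t)) * S 0 t ≤ C * Real.sqrt ν

/-- **Any proof of K1 must use the DLR equations** (two-site content): the weakened statement is
false, by the uniform-oscillation arena of `Negative/FalseWithoutGibbs.lean`. [folklore] -/
theorem localEnergyHalfHoelder_false_without_gibbs : ¬ LocalEnergyHalfHoelderWithoutGibbs :=
  FalseWithoutGibbs.localEnergyHalfHoelder_false_without_isChainGibbsMeasure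

/-- The arena's state is not a DLR state of any chain (so it does not touch K1 itself). [folklore] -/
theorem arena_not_gibbs {ω₂ lam : ℝ} (hω : 0 < ω₂) (hl : 0 ≤ lam) (P : OscillatorChain) (T : ℝ) :
    ¬ P.IsChainGibbsMeasure T (UniformOscillationArena.μu ω₂ lam) :=
  FalseWithoutGibbs.not_isChainGibbsMeasure_μu hω hl P T

/-- K1 with the DLR guard replaced by "probability + the ONE-SITE non-atomicity consequences of DLR
that the tree's negative files have used so far" (`μ{σ 0 = v} = 0` for every `v`, as in
`IsChainGibbsMeasure.measure_coord_eq_zero`; `μ{p_0 = 0} = 0`, as in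
`FrozenFlowExcluded.gibbs_momentum_zero_null`), everything else verbatim. [folklore] -/
def LocalEnergyHalfHoelderWithOneSiteGuard : Prop :=
  ∀ ω₂ lam β γ : ℝ, 0 < ω₂ → 0 < lam → 0 < β → ∀ T : ℝ, 0 < T → ∀ μ : MeasureTheory.Measure Literature.MathematicalPhysics.KineticTheory.HeatConduction.ChainConfig, MeasureTheory.IsProbabilityMeasure μ → (∀ v : ℝ × ℝ, μ {σ | σ 0 = v} = 0) → μ {σ | (σ 0).2 = 0} = 0 → Literature.MathematicalPhysics.KineticTheory.HeatConduction.IsShiftInvariant μ → μ.map (fun σ : Literature.MathematicalPhysics.KineticTheory.HeatConduction.ChainConfig => fun x : ℤ => ((σ x).1, -(σ x).2)) = μ → ∀ D : Literature.MathematicalPhysics.KineticTheory.HeatConduction.InfiniteChainDynamics (Literature.MathematicalPhysics.KineticTheory.HeatConduction.pinnedChain ω₂ lam β γ), D.PreservesMeasure μ → (∀ t : ℝ, ∀ᵐ σ ∂μ, D.flow t (Literature.MathematicalPhysics.KineticTheory.HeatConduction.shift σ) = Literature.MathematicalPhysics.KineticTheory.HeatConduction.shift (D.flow t σ)) → ∀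 h : Literature.MathematicalPhysics.KineticTheory.HeatConduction.ChainConfig → ℤ → ℝ, h = (fun (σ : Literature.MathematicalPhysics.KineticTheory.HeatConduction.ChainConfig) (x : ℤ) => (σ x).2 ^ 2 / 2 + (Literature.MathematicalPhysics.KineticTheory.HeatConduction.pinnedChain ω₂ lam β γ).U (σ x).1 + ((Literature.MathematicalPhysics.KineticTheory.HeatConduction.pinnedChain ω₂ lam β γ).V ((σ (x + 1)).1 - (σ x).1) + (Literature.MathematicalPhysics.KineticTheory.HeatConduction.pinnedChain ω₂ lam β γ).V ((σ x).1 - (σ (x - 1)).1)) / 2) → ∀ S : ℤ → ℝ → ℝ, S = (fun (x : ℤ) (t : ℝ) => ∫ σ, (h σ 0 - ∫ σ', h σ' 0 ∂μ) * (h (D.flow t σ) x - ∫ σ', h σ' 0 ∂μ) ∂μ) → (∀ ν : ℝ, 0 < ν → MeasureTheory.IntegrableOn (fun t : ℝ => Real.exp (-(ν * t)) * S 0 t) (Set.Ioi 0)) → ∃ C ν₀ : ℝ, 0 < ν₀ ∧ ∀ ν : ℝ, 0 < ν → ν ≤ ν₀ → ν * ∫ t in Set.Ioi (0:ℝ), Real.exp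 (-(ν * t)) * S 0 t ≤ C * Real.sqrt ν

/-- **One-site non-atomicity is not what K1 needs from DLR**: the statement above is FALSE, by the
same uniform-oscillation arena (its one-site law is the normalised Liouville law of the shell,
`FalseWithoutGibbs.μu_coord_eq_null`, `μu_momentum_zero_null`). A proof of K1 must use the
conditional structure of `μ` ACROSS sites (e.g. the two-site consequence
`FalseWithoutGibbs.gibbs_coincidence_null`). [folklore] -/
theorem localEnergyHalfHoelder_false_with_oneSite_guard : ¬ LocalEnergyHalfHoelderWithOneSiteGuard := by
  intro H
  have hω : (0:ℝ) < 1 := one_pos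
  haveI := UniformOscillationArena.isProbabilityMeasure_μu (ω₂ := 1) (lam := 1) hω zero_le_one
  set μ := UniformOscillationArena.μu (1:ℝ) 1 with hμ
  set D := UniformOscillationArena.unifDynamics (ω₂ := 1) (lam := 1) hω.le zero_le_one 1 0 with hD
  set m : ℝ := ∫ σ', FalseWithoutGibbs.siteE 1 1 1 0 σ' 0 ∂μ with hm
  set v : ℝ := ∫ z, (UniformOscillationFlow.Hd 1 1 z - m) ^ 2 ∂(UniformOscillationArena.ρ 1 1) with hv
  have hvpos : 0 < v := FalseWithoutGibbs.variance_pos hω zero_le_one m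
  have hS : ∀ t : ℝ, ∫ σ, (FalseWithoutGibbs.siteE 1 1 1 0 σ 0 - m) *
      (FalseWithoutGibbs.siteE 1 1 1 0 (D.flow t σ) 0 - m) ∂μ = v :=
    fun t => FalseWithoutGibbs.covariance_eq_variance hω.le zero_le_one 1 0 m t
  obtain ⟨C, ν₀, hν₀, hC⟩ := H 1 1 1 0 one_pos one_pos one_pos 1 one_pos μ inferInstance
    (fun w => FalseWithoutGibbs.μu_coord_eq_null w) FalseWithoutGibbs.μu_momentum_zero_null
    UniformOscillationArena.isShiftInvariant_μu UniformOscillationArena.reversal_μu D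
    (UniformOscillationArena.preservesMeasure_unifDynamics hω.le zero_le_one 1 0)
    (UniformOscillationArena.shift_comm_unifDynamics hω.le zero_le_one 1 0)
    (FalseWithoutGibbs.siteE 1 1 1 0) rfl _ rfl (fun ν hν => by
      show IntegrableOn (fun t : ℝ => Real.exp (-(ν * t)) *
        ∫ σ, (FalseWithoutGibbs.siteE 1 1 1 0 σ 0 - m) *
          (FalseWithoutGibbs.siteE 1 1 1 0 (D.flow t σ) 0 - m) ∂μ) (Ioi 0)
      simp_rw [hS]
      have h3 : IntegrableOn (fun t : ℝ => Real.exp (-ν * t)) (Ioi 0) := exp_neg_integrableOn_Ioi 0 hν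
      have h4 : IntegrableOn (fun t : ℝ => Real.exp (-ν * t) * v) (Ioi 0) := h3.mul_const v
      have h5 : (fun t : ℝ => Real.exp (-(ν * t)) * v) = fun t => Real.exp (-ν * t) * v := by
        funext t; rw [neg_mul]
      rw [h5]; exact h4)
  refine FalseWithoutGibbs.not_halfHoelder_of_const_pos hvpos (C := C) hν₀ fun ν hν hle => ?_
  have h := hC ν hν hle
  change ν * ∫ t in Ioi (0:ℝ), Real.exp (-(ν * t)) *
      ∫ σ, (FalseWithoutGibbs.siteE 1 1 1 0 σ 0 - m) *
        (FalseWithoutGibbs.siteE 1 1 1 0 (D.flow t σ) 0 - m) ∂μ ≤ C * Real.sqrt ν at h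
  simp_rw [hS] at h
  rwa [FalseWithoutGibbs.abelMean_const hν] at h

/-- K1 with the guard `D.PreservesMeasure μ` dropped (everything else verbatim). [folklore] -/
def LocalEnergyHalfHoelderWithoutPreservesMeasure : Prop :=
  ∀ ω₂ lam β γ : ℝ, 0 < ω₂ → 0 < lam → 0 < β → ∀ T : ℝ, 0 < T → ∀ μ : MeasureTheory.Measure Literature.MathematicalPhysics.KineticTheory.HeatConduction.ChainConfig, (Literature.MathematicalPhysics.KineticTheory.HeatConduction.pinnedChain ω₂ lam β γ).IsChainGibbsMeasure T μ → Literature.MathematicalPhysics.KineticTheory.HeatConduction.IsShiftInvariant μ → μ.map (fun σ : Literature.MathematicalPhysics.KineticTheory.HeatConduction.ChainConfig => fun x : ℤ => ((σ x).1, -(σ x).2)) = μ → ∀ D : Literature.MathematicalPhysics.KineticTheory.HeatConduction.InfiniteChainDynamics (Literature.MathematicalPhysics.KineticTheory.HeatConduction.pinnedChain ω₂ lam β γ),  (∀ t : ℝ, ∀ᵐ σ ∂μ, D.flow t (Literature.MathematicalPhysics.KineticTheory.HeatConduction.shift σ) = Literature.MathematicalPhysics.KineticTheory.HeatConduction.shift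 (D.flow t σ)) → ∀ h : Literature.MathematicalPhysics.KineticTheory.HeatConduction.ChainConfig → ℤ → ℝ, h = (fun (σ : Literature.MathematicalPhysics.KineticTheory.HeatConduction.ChainConfig) (x : ℤ) => (σ x).2 ^ 2 / 2 + (Literature.MathematicalPhysics.KineticTheory.HeatConduction.pinnedChain ω₂ lam β γ).U (σ x).1 + ((Literature.MathematicalPhysics.KineticTheory.HeatConduction.pinnedChain ω₂ lam β γ).V ((σ (x + 1)).1 - (σ x).1) + (Literature.MathematicalPhysics.KineticTheory.HeatConduction.pinnedChain ω₂ lam β γ).V ((σ x).1 - (σ (x - 1)).1)) / 2) → ∀ S : ℤ → ℝ → ℝ, S = (fun (x : ℤ) (t : ℝ) => ∫ σ, (h σ 0 - ∫ σ', h σ' 0 ∂μ) * (h (D.flow t σ) x - ∫ σ', h σ' 0 ∂μ) ∂μ) → (∀ ν : ℝ, 0 < ν → MeasureTheory.IntegrableOn (fun t : ℝ => Real.exp (-(ν * t)) * S 0 t) (Set.Ioi 0)) → ∃ C ν₀ : ℝ, 0 < ν₀ ∧ ∀ ν : ℝ, 0 < ν → ν ≤ ν₀ → ν * ∫ t in Set.Ioi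 (0:ℝ), Real.exp (-(ν * t)) * S 0 t ≤ C * Real.sqrt ν

/-- **`PreservesMeasure` is load-bearing, given a Gibbs state** (landed p160247,
`Negative/FalseWithoutPreservesMeasure.lean`): for ANY shift- and reversal-invariant DLR state `μ`
of `pinnedChain 1 1 1 0` at `T = 1` with `h_0 ∈ L²(μ)` (hypothesis = the `μ`-half of crux
SymmetricSetup, stmt-11036, plus a moment bound — not constructed in the tree, hence conditional),
the frozen `restDynamics` (carrier `{rest}`, `φ_t = id`) is an admissible `D` once preservation is
not asked and gives `S(0,t) ≡ Var_μ(h_0) > 0`. [folklore] -/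
theorem localEnergyHalfHoelder_false_without_preservesMeasure_of_gibbsState
    (hex : ∃ μ : Measure ChainConfig, (pinnedChain 1 1 1 0).IsChainGibbsMeasure 1 μ ∧
      IsShiftInvariant μ ∧ μ.map (fun σ : ChainConfig => fun x : ℤ => ((σ x).1, -(σ x).2)) = μ ∧
      MemLp (fun σ : ChainConfig => FalseWithoutGibbs.siteE 1 1 1 0 σ 0) 2 μ) :
    ¬ LocalEnergyHalfHoelderWithoutPreservesMeasure :=
  FalseWithoutPreservesMeasure.localEnergyHalfHoelder_false_without_preservesMeasure_of_gibbsState hex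

/-- K1 with the parameter guards relaxed to `0 ≤ lam`, `0 ≤ β` (harmonic member allowed).
EXPECTED TRUE (harmonic chain: `S(0,t) ≍ 1/t`, `Ψ ≍ ν log(1/ν) ≤ C√ν`; census numerics point H):
the guards are not load-bearing for K1, only for the route's finiteness side. Recorded so that no
seat hunts a harmonic counterexample to K1. [folklore] -/
def LocalEnergyHalfHoelderHarmonicAllowed : Prop :=
  ∀ ω₂ lam β γ : ℝ, 0 < ω₂ → 0 ≤ lam → 0 ≤ β → ∀ T : ℝ, 0 < T → ∀ μ : MeasureTheory.Measure Literature.MathematicalPhysics.KineticTheory.HeatConduction.ChainConfig, (Literature.MathematicalPhysics.KineticTheory.HeatConduction.pinnedChain ω₂ lam β γ).IsChainGibbsMeasure T μ → Literature.MathematicalPhysics.KineticTheory.HeatConduction.IsShiftInvariant μ → μ.map (fun σ : Literature.MathematicalPhysics.KineticTheory.HeatConduction.ChainConfig => fun x : ℤ => ((σ x).1, -(σ x).2)) = μ → ∀ D : Literature.MathematicalPhysics.KineticTheory.HeatConduction.InfiniteChainDynamics (Literature.MathematicalPhysics.KineticTheory.HeatConduction.pinnedChain ω₂ lam β γ), D.PreservesMeasure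 μ → (∀ t : ℝ, ∀ᵐ σ ∂μ, D.flow t (Literature.MathematicalPhysics.KineticTheory.HeatConduction.shift σ) = Literature.MathematicalPhysics.KineticTheory.HeatConduction.shift (D.flow t σ)) → ∀ h : Literature.MathematicalPhysics.KineticTheory.HeatConduction.ChainConfig → ℤ → ℝ, h = (fun (σ : Literature.MathematicalPhysics.KineticTheory.HeatConduction.ChainConfig) (x : ℤ) => (σ x).2 ^ 2 / 2 + (Literature.MathematicalPhysics.KineticTheory.HeatConduction.pinnedChain ω₂ lam β γ).U (σ x).1 + ((Literature.MathematicalPhysics.KineticTheory.HeatConduction.pinnedChain ω₂ lam β γ).V ((σ (x + 1)).1 - (σ x).1) + (Literature.MathematicalPhysics.KineticTheory.HeatConduction.pinnedChain ω₂ lam β γ).V ((σ x).1 - (σ (x - 1)).1)) / 2) → ∀ S : ℤ → ℝ → ℝ, S = (fun (x : ℤ) (t : ℝ) => ∫ σ, (h σ 0 - ∫ σ', h σ' 0 ∂μ) * (h (D.flow t σ) x - ∫ σ', h σ' 0 ∂μ) ∂μ) → (∀ ν : ℝ, 0 < ν → MeasureTheory.IntegrableOn (fun t : ℝ => Real.exp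 (-(ν * t)) * S 0 t) (Set.Ioi 0)) → ∃ C ν₀ : ℝ, 0 < ν₀ ∧ ∀ ν : ℝ, 0 < ν → ν ≤ ν₀ → ν * ∫ t in Set.Ioi (0:ℝ), Real.exp (-(ν * t)) * S 0 t ≤ C * Real.sqrt ν

/-! ## Index of the landed negative content (re-exported for ideators / the lead) -/

-- The arena itself: `FalseWithoutGibbs.uniform_arena` (∃ μ D v, all guards but DLR ∧ 0 < v ∧ S(0,·) ≡ v),
-- with named parts `UniformOscillationArena.μu`, `UniformOscillationArena.unifDynamics`,
-- `FalseWithoutGibbs.covariance_eq_variance`, `FalseWithoutGibbs.variance_pos`.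

/-- KILL CRITERION, checked form: a tail slower than `t^{-1/2}` refutes the conclusion shape of K1
(`SlowTailExcluded`, p161031). [folklore] -/
theorem slow_tail_kills {S : ℝ → ℝ} {a t₀ α B : ℝ} (ha : 0 < a) (ht₀ : 0 < t₀)
    (hα : α < 1 / 2) (hB : 0 ≤ B)
    (hS : ∀ t, t₀ ≤ t → a * t ^ (-α) ≤ S t) (hlow : ∀ t, 0 < t → -B ≤ S t)
    (hint : ∀ ν : ℝ, 0 < ν → IntegrableOn (fun t => Real.exp (-(ν * t)) * S t) (Ioi 0)) :
    ¬ ∃ C ν₀ : ℝ, 0 < ν₀ ∧ ∀ ν : ℝ, 0 < ν → ν ≤ ν₀ →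
        ν * ∫ t in Ioi (0:ℝ), Real.exp (-(ν * t)) * S t ≤ C * Real.sqrt ν :=
  SlowTailExcluded.not_halfHoelder_of_slow_tail ha ht₀ hα hB hS hlow hint

/-- The frozen flow is excluded by the guards (prior seat). [folklore] -/
theorem frozen_excluded (P : OscillatorChain) (T : ℝ) (μ : Measure ChainConfig)
    (hG : P.IsChainGibbsMeasure T μ) (D : InfiniteChainDynamics P) (hP : D.PreservesMeasure μ)
    (hfrozen : ∀ σ ∈ D.carrier, ∀ t, D.flow t σ = σ) : False :=
  FrozenFlowExcluded.no_frozen_dynamics P T μ hG D hP hfrozen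

end Summit.AtomisticToContinuum.FouriersLaw.Cruxes.LocalEnergyHalfHoelder.Disproof

end
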